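import Literature.AlgebraicGeometry.HodgeTheory.InvariantClassesFromTotalSpaceCurveBase
import Literature.AlgebraicGeometry.Motives.VarietiesDimensionProofs
import Summits.HodgeConjecture.HodgeConjecture.Theorems.Ring2HypothesesFlatSectionsCurveBase
import Summits.HodgeConjecture.HodgeConjecture.Theorems.Ring2HypothesesFlatSectionsOfPartieFixe
import HarnessLib

/-!
# Ring 2 — hypotheses layer: `VHC ⟹ FlatSectionsAlgebraic` over ALL smooth irreducible bases WITHOUT Hodge II — modulo Mumford's curve lemma only

HONEST FRAMING: research route conditional on HC_CM; not a corollary; Q11.4-sentence-2 already refuted in dim ≥ 3.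

Cell `pub-hodge-ring2`, binder-prover seat `ring2-b01` (gen 6), BINDER-OWNERS row b04
(`Ring2.Hypotheses.FlatSectionsAlgebraic`). `HC_CM` (`Theses.RankFourFaces.CMAbelianHodge`) does not occur in this
file; nothing here proves a case of the Hodge conjecture. No definition, no named fact, no `sorry`.

## What this part adds

Module 2 of this seat (`Ring2HypothesesFlatSectionsOfPartieFixe`, gen 1) closed the row-b04 residual MODULO the
named fact `deligne1971_invariantClass_fromTotalSpace_proper` (Deligne, *Hodge II*, Thm. 4.1.1 (i): the partie fixe
for PROPER smooth morphisms — a deep theorem, "net debt +1"). This part pays that debt down to Mumford's curve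
lemma (`Motives.mumford_smoothCurve_through_two_points`, *Abelian Varieties* §6, an elementary Bertini statement
already binding ten files of the tree), using NO Hodge theory at all:

* the flat-section node is local on the base and reduces to smooth irreducible affine CURVE bases
  (ring2-b04's `flatSectionsAlgebraic_of_curveBase`, granted Mumford's lemma);
* over a smooth affine curve `S`, Deligne's invariant cycle theorem holds for EVERY smooth proper family — no
  projectivity, no Lefschetz class, no Hodge II: `S(ℂ)` is an open Riemann surface, exhausted by compact sublevel
  sets homotopy equivalent to finite `1`-complexes (Andreotti–Frankel / Milnor Thm. 7.2, PROVED in the tree), so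
  the Leray spectral sequence of `f(ℂ)` has two columns and degenerates (the tree theorems
  `SerreInvariantCycles.exists_class_of_flat_of_exhaustion` and
  `HodgeTheory.invariantClass_fromTotalSpace_of_affineCurveBase`, landed with this part);
* hence `VHC` (global-class form, item 1076) transports algebraicity of flat sections over curve bases, and

**`flatSectionsAlgebraic_of_vhc_of_mumford : mumford_smoothCurve_through_two_points → VHC → FlatSectionsAlgebraic`**,
**`flatSectionsAlgebraic_iff_vhc_of_mumford : mumford_smoothCurve_through_two_points → (FlatSectionsAlgebraic ↔ VHC)`**.

Row b04 then reads «≡ b03 modulo Mumford's curve lemma» instead of «≡ b03 modulo Hodge II 4.1.1 (i)»; the deep input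
(c15) is no longer on the path between the two typed forms of Charles–Schnell Conj. 11.3.1.

* `smoothOfRelativeDimension_one_of_topologicalKrullDim` — bookkeeping: a smooth irreducible affine `ℂ`-scheme of
  topological Krull dimension `1` is smooth of relative dimension `1` (relative dimension is constant on a connected
  `S(ℂ)`, and equals the dimension).
* `exists_globalSection_eq_of_flatSection_of_curveBase` — over a smooth irreducible affine curve a flat section of ANY
  smooth proper family with projective fibres is the section of ONE global class (unconditional).
* `flatSection_algebraic_of_vhc_of_curveBase` — `VHC ⟹` the curve-base statement `h` of `flatSectionsAlgebraic_of_curveBase`.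

References: [MumfordAV1970] §6 Lemma; [VoisinHodgeII2003] Thm. 1.22, Lemma 4.17, Thm. 4.18; [Milnor1963] Thm. 7.2;
[CharlesSchnell2014Notes] Conj. 11.3.1, Prop. 11.3.5; [DeligneHodgeII1971] Thm. 4.1.1 (for comparison only).
-/

-- every declaration of this problem lives in `Summit.HodgeConjecture.HodgeConjecture.…` (summit = sub-problem)
set_option linter.dupNamespace false

noncomputable section

open CategoryTheory AlgebraicGeometry Topology Filter
open Literature.AlgebraicGeometry Literature.AlgebraicGeometry.Motives Literature.AlgebraicGeometry.HodgeTheory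

namespace Summit.HodgeConjecture.HodgeConjecture.Ring2.Hypotheses

/-! ## Curve bases: relative dimension `1` -/

/-- **A smooth irreducible `ℂ`-scheme of topological Krull dimension `1` is smooth of relative dimension `1`**:
`S(ℂ)` is connected (`S` irreducible), so `S` is smooth of SOME relative dimension `d`
(`exists_smoothOfRelativeDimension_of_connectedSpace_complexPoints`), and `dim S = d`
(`Motives.topologicalKrullDim_eq_of_smoothOfRelativeDimension`). [cite: GortzWedhorn2020, Lemma 6.26 and Thm. 6.28] -/
theorem smoothOfRelativeDimension_one_of_topologicalKrullDim (S : SchemeOver ℂ) [IrreducibleSpace S.left]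
    [AlgebraicGeometry.Smooth S.hom] (hdim : topologicalKrullDim S.left = 1) :
    SmoothOfRelativeDimension 1 S.hom := by
  haveI : LocallyOfFiniteType S.hom := inferInstance
  haveI : ConnectedSpace (ComplexPoints S) := (ComplexPoints.connectedSpace_iff_holds S).2 inferInstance
  obtain ⟨d, hd⟩ := exists_smoothOfRelativeDimension_of_connectedSpace_complexPoints S
  haveI := hd
  have h := Motives.topologicalKrullDim_eq_of_smoothOfRelativeDimension S.hom d
  rw [hdim] at h
  have hd1 : d = 1 := by exact_mod_cast h.symm
  subst hd1
  exact hd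

/-! ## A flat section over a curve base is the section of one global class — unconditionally -/

/-- **Over a smooth irreducible affine curve, a flat section of ANY smooth proper family with projective fibres is
the section of ONE global class** — no projectivity of the total space, no named fact: the tree theorem
`HodgeTheory.invariantClass_fromTotalSpace_of_affineCurveBase` (Andreotti–Frankel exhaustion of `S(ℂ)` +
`SerreInvariantCycles.exists_class_of_flat_of_exhaustion`) at one point, then the identity principle for
continuous sections of the local system `Rᵏ f_* ℂ` over the connected manifold `S(ℂ)` (Ehresmann over any smooth
base, `isCohomologicallyLocallyTrivialOn_univ_of_isSmoothProjectiveFamily_of_smooth`;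
`Theorems.HeckePrymWeilLine.gcs_section_eq_of_eq`). [cite: VoisinHodgeII2003, Thm. 4.18 and Lemma 4.17]
[cite: Milnor1963, §7 Thm. 7.2] -/
theorem exists_globalSection_eq_of_flatSection_of_curveBase {n : ℕ} {𝒳 S : SchemeOver ℂ} (f : 𝒳 ⟶ S)
    (hf : IsSmoothProjectiveFamily f n) (hirr : IrreducibleSpace S.left) (haff : IsAffine S.left)
    (hsm : AlgebraicGeometry.Smooth S.hom) (hdim : topologicalKrullDim S.left = 1) (k : ℕ)
    {σ : ComplexPoints S → FiberClass f k} (hσ : Continuous σ) (hpt : ∀ s, (σ s).pt = s) :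
    ∃ β : complexBetti 𝒳 k, ∀ s, σ s = globalSection f k β s := by
  haveI := hsm
  haveI := hirr
  haveI := haff
  haveI : LocallyOfFiniteType S.hom := inferInstance
  haveI : ConnectedSpace (ComplexPoints S) := (ComplexPoints.connectedSpace_iff_holds S).2 inferInstance
  haveI : SmoothOfRelativeDimension 1 S.hom := smoothOfRelativeDimension_one_of_topologicalKrullDim S hdim
  haveI := pathConnectedSpace_complexPoints_of_smoothOfRelativeDimension S 1
  have hU := isCohomologicallyLocallyTrivialOn_univ_of_isSmoothProjectiveFamily_of_smooth f hf
  obtain ⟨s₀⟩ := (inferInstance : Nonempty (ComplexPoints S))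
  obtain ⟨β, hβ⟩ := invariantClass_fromTotalSpace_of_affineCurveBase f hf k σ hσ hpt s₀
  exact ⟨β, Theorems.HeckePrymWeilLine.gcs_section_eq_of_eq f k hU hσ hpt (continuous_globalSection f k β)
    (fun _ => rfl) hβ⟩

/-! ## `VHC ⟹ FlatSectionsAlgebraic`, modulo Mumford's curve lemma only -/

/-- **`VHC ⟹` the curve-base flat-section statement** (the hypothesis `h` of ring2-b04's
`flatSectionsAlgebraic_of_curveBase`), unconditionally: over a smooth irreducible affine curve the flat section is
the section of one global class `β` (`exists_globalSection_eq_of_flatSection_of_curveBase`), which is fibrewise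
rational `(p,p)` and algebraic at the anchor, so `VHC` (item 1076, global-class form) transports — verbatim the
argument of `flatSection_algebraic_of_deligne1971_of_vhc_of_isQuasiProjectiveOver_base` with the theorem in place
of the fact. [cite: CharlesSchnell2014Notes, Conj. 11.3.1 and proof of Prop. 11.3.5]
[cite: VoisinHodgeII2003, Thm. 4.18] -/
theorem flatSection_algebraic_of_vhc_of_curveBase (hV : Theses.AnchorTransport.VariationalHodge)
    ⦃n : ℕ⦄ ⦃𝒳 S : SchemeOver ℂ⦄ (f : 𝒳 ⟶ S) (hf : IsSmoothProjectiveFamily f n)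
    (hirr : IrreducibleSpace S.left) (haff : IsAffine S.left) (hsm : AlgebraicGeometry.Smooth S.hom)
    (hdim : topologicalKrullDim S.left = 1)
    (p : ℕ) (σ : ComplexPoints S → FiberClass f (2 * p)) (hσ : Continuous σ) (hpt : ∀ s, (σ s).pt = s)
    (hH : ∀ s, σ s ∈ locusOfHodgeClasses f n p)
    (h₀ : ∃ s₀, (σ s₀).cls ∈ algebraicClasses (fiberOver f (σ s₀).pt) p) (s : ComplexPoints S) :
    (σ s).cls ∈ algebraicClasses (fiberOver f (σ s).pt) p := by
  obtain ⟨s₀, hs₀⟩ := h₀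
  obtain ⟨β, hσβ⟩ := exists_globalSection_eq_of_flatSection_of_curveBase f hf hirr haff hsm hdim (2 * p) hσ hpt
  have hA : ∀ t : ComplexPoints S, IsRationalClass (complexBetti.map (fiberι f t) (2 * p) β) ∧
      IsOfHodgeType n (fiberOver f t) (2 * p) p p (complexBetti.map (fiberι f t) (2 * p) β) := fun t =>
    fiberClass_transfer_of_eq_mk (hσβ t)
      (fun t c => IsRationalClass c ∧ IsOfHodgeType n (fiberOver f t) (2 * p) p p c)
      ((mem_locusOfHodgeClasses_iff _).1 (hH t))
  have hβ₀ : complexBetti.map (fiberι f s₀) (2 * p) β ∈ algebraicClasses (fiberOver f s₀) p :=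
    fiberClass_transfer_of_eq_mk (hσβ s₀) (fun t c => c ∈ algebraicClasses (fiberOver f t) p) hs₀
  exact fiberClass_transfer_to_eq_mk (hσβ s) (fun t c => c ∈ algebraicClasses (fiberOver f t) p)
    (hV f hf hirr hsm p β hA ⟨s₀, hβ₀⟩ s)

/-- **`VHC ∧ (Mumford's curve lemma) ⟹ FlatSectionsAlgebraic` over ALL smooth irreducible bases — WITHOUT Hodge II.**
Ring2-b04's reduction `flatSectionsAlgebraic_of_curveBase` (local on the base; curves through two points inside an
affine irreducible piece, `mumford_smoothCurve_through_two_points`) fed with `flatSection_algebraic_of_vhc_of_curveBase`.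
Compare module 2's `flatSectionsAlgebraic_of_deligne1971_of_vhc` (same conclusion modulo Deligne, Hodge II,
Thm. 4.1.1 (i) instead). `HC_CM` plays no role; no case of the Hodge conjecture is proved.
[cite: MumfordAV1970, §6, Lemma] [cite: CharlesSchnell2014Notes, Conj. 11.3.1, Thm. 11.3.4 and Prop. 11.3.5] -/
theorem flatSectionsAlgebraic_of_vhc_of_mumford (hC : mumford_smoothCurve_through_two_points)
    (hV : Theses.AnchorTransport.VariationalHodge) : FlatSectionsAlgebraic :=
  flatSectionsAlgebraic_of_curveBase hC fun _ _ _ f hf hirr haff hsm hdim p σ hσ hpt hH h₀ s =>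
    flatSection_algebraic_of_vhc_of_curveBase hV f hf hirr haff hsm hdim p σ hσ hpt hH h₀ s

/-- **Modulo Mumford's curve lemma, the flat-section node and the global-class node are ONE node in the typed
generality: `FlatSectionsAlgebraic ↔ VHC`** (with part I's `vhc_of_flatSectionsAlgebraic`). The previous version
`flatSectionsAlgebraic_iff_vhc_of_deligne1971` needed Deligne's partie fixe for proper smooth morphisms; here the only
input is an elementary Bertini-type statement. [cite: MumfordAV1970, §6, Lemma]
[cite: CharlesSchnell2014Notes, Conj. 11.3.1 and Prop. 11.3.5] -/
theorem flatSectionsAlgebraic_iff_vhc_of_mumford (hC : mumford_smoothCurve_through_two_points) :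
    FlatSectionsAlgebraic ↔ Theses.AnchorTransport.VariationalHodge :=
  ⟨vhc_of_flatSectionsAlgebraic, flatSectionsAlgebraic_of_vhc_of_mumford hC⟩

/-! ## Audit: no definition, no named fact introduced, no `sorry`; `HC_CM` does not occur; the displayed hypotheses are
`hC` (Mumford's lemma, an existing Literature named fact) and `hV` (item 1076). Standard axioms only. -/

#print axioms Summit.HodgeConjecture.HodgeConjecture.Ring2.Hypotheses.flatSectionsAlgebraic_of_vhc_of_mumford
#print axioms Summit.HodgeConjecture.HodgeConjecture.Ring2.Hypotheses.flatSectionsAlgebraic_iff_vhc_of_mumford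

end Summit.HodgeConjecture.HodgeConjecture.Ring2.Hypotheses

end
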